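import Summits.HodgeConjecture.HodgeConjecture.Theorems.Ring2AbelianAllAndreSporadicClasses
import HarnessLib

/-!
# Ring 2 · sub-cell AbelianAll (ALL ABELIAN VARIETIES), André axis, part XXXI-d — SPORADIC ALGEBRAIC CLASSES, GOOD
# FIBRES: on a compact pencil of abelian varieties the set of fibres at which EVERY invariant Hodge class (global
# class with rational `(p,p)` restrictions) is algebraic is COUNTABLE OR EVERYTHING (no named fact); uncountably many
# good fibres give the lift `(L)_t(p)` at every `t` (Verdier); under `HC_CM` the CM fibres are good, so `B_min` on a
# CM-pointed pencil ⟺ "uncountably many good fibres", holds outright when the CM locus is uncountable, and holds at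
# ALL CM points of the pencil as soon as it holds at ONE

HONEST FRAMING (page 1, verbatim): **research route, not a corollary; conditional on HC_CM plus one named
minimal statement.** Cell line: research route conditional on HC_CM; not a corollary; Q11.4-sentence-2 already
refuted in dim ≥ 3. Nothing in this file proves a case of the Hodge conjecture for an abelian variety. `HC_CM`
(`Theses.RankFourFaces.CMAbelianHodge`) is a BINDER in §3; `hGT` = Verdier's generic local triviality is a NAMED-FACT
BINDER; the reduction item `CMToAbelian` (stmt-HodgeConjecture-16267) is NOT closed here; the cell's `B_min` of record
(N104) is untouched; NO node is born (0 `def`), nothing is claimed minimal. KIND (honest column): "uncountably many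
good fibres on every CM-pointed pencil" is a HODGE-input statement and, like the faces F₁–F₄ graded by seat
ab-spread-1's part XXXI, would re-derive `HC_CM` on constant pencils — it is displayed here PER PENCIL as a reading of
`B_min` under `HC_CM`, not as a candidate; the algebraic-input, `HC_CM`-idle form is (4_ℵ) of part XXXI-b.

## Content (`f : 𝒳 ⟶ S` a compact pencil of abelian `d`-folds; "`s` is `p`-good" := every `W ∈ H²ᵖ(𝒳(ℂ); ℂ)` whose
## fibre restrictions are all rational of type `(p,p)` has `W|_{𝒳_s}` algebraic)

* §1 (fact-free) **DICHOTOMY** `goodFibres_countable_or_forall`: the `p`-good fibres are countably many, or all —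
  either every such `W` is algebraic on every fibre, or one of them is not, and then the good fibres lie in its
  algebraicity locus, which is countable by part XXXI-a §2.
* §2 [Verdier] `comap_le_sup_of_not_countable_good_of_verdier`: uncountably many `p`-good fibres ⟹ `(L)_t(p)` at
  every `t` (sharpens part XXXI-b §7: only the INVARIANT Hodge classes of the members are asked to be algebraic);
  `invariantCyclesHoldFor_of_forall_not_countable_good` (fact-free): then Abdulali's (1.1)_f.
* §3 [`HC_CM`] `good_of_mem_cmLocus_of_HC_CM`: CM fibres are good; hence (Verdier) **a pencil with UNCOUNTABLE CM
  locus satisfies `(L)_t(p)` at every `t`** (`comap_le_sup_of_not_countable_cmLocus_of_HC_CM_of_verdier`); **at a CM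
  point, `(L)_t(p)` ⟺ the `p`-good fibres are uncountably many ⟺ every fibre is `p`-good**
  (`comap_le_sup_iff_not_countable_good_of_HC_CM_of_verdier`); so on each pencil `B_min` in degree `2p` holds at ALL
  CM points or at NONE (`comap_le_sup_of_comap_le_sup_cm_of_HC_CM_of_verdier`: at one CM point ⟹ at every point).

EDGE LABELS: §1 and the (1.1)_f row fact-free; §2 K[Verdier]; §3 `HC_CM` binder (+ K[Verdier] where `hGT` occurs).
No `def`, no `sorry`; axioms standard.

References: CharlesSchnell2014Notes (Prop. 11.3.11 (proof), Prop. 11.3.5, Cor. 11.3.6); Verdier1976 (Cor. (5.1));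
Andre1996Motifs (§5.1 (A3)–(A4) p. 25, §6.3 a) and Remarque 2 p. 33); Abdulali1994FamiliesAV ((1.1) p. 1122, Lemma
6.2 p. 1131); DeligneHodgeII1971 (Thm. 4.1.1, Cor. 4.1.2); Deligne1982HodgeCycles (§6, proof of Prop. 6.1).
-/

noncomputable section

set_option linter.dupNamespace false

namespace Summit.HodgeConjecture.HodgeConjecture.Ring2.AbelianAll

open CategoryTheory AlgebraicGeometry
open Literature.AlgebraicGeometry Literature.AlgebraicGeometry.Motives
open Literature.AlgebraicGeometry.HodgeTheory
open Literature.AlgebraicGeometry.Abdulali1994 (InvariantCyclesHoldFor)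
open Literature.AlgebraicGeometry.Deligne1982 (cmLocus)
open Summit.HodgeConjecture.HodgeConjecture
open Summit.HodgeConjecture.HodgeConjecture.Theses

variable {𝒳 S : SchemeOver ℂ} {d : ℕ} {f : 𝒳 ⟶ S}

/-! ## §1 The good fibres of a pencil: countably many, or all (no named fact) -/

/-- **DICHOTOMY FOR THE GOOD FIBRES (fact-free).** On a compact pencil `f : 𝒳 ⟶ S` of abelian `d`-folds, fix `p`
and call `s` GOOD if every global class `W ∈ H²ᵖ(𝒳(ℂ); ℂ)` with rational `(p,p)` fibre restrictions is algebraic on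
`𝒳_s`. Then the good fibres are COUNTABLY many, or EVERY fibre is good: if some such `W` fails to be algebraic on some
fibre, its algebraicity locus is not everything, hence countable (part XXXI-a `algebraicityLocus_countable_or_forall`),
and it contains every good fibre. [cite: CharlesSchnell2014Notes, Prop. 11.3.11 (proof)] [cite: DeligneHodgeII1971, Cor. 4.1.2] -/
theorem goodFibres_countable_or_forall (hf : IsCompactAbelianPencil f d) (p : ℕ) :
    {s : ComplexPoints S | ∀ W : complexBetti 𝒳 (2 * p),
        (∀ s' : ComplexPoints S, IsRationalClass (complexBetti.map (fiberι f s') (2 * p) W) ∧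
          IsOfHodgeType d (fiberOver f s') (2 * p) p p (complexBetti.map (fiberι f s') (2 * p) W)) →
        complexBetti.map (fiberι f s) (2 * p) W ∈ algebraicClasses (fiberOver f s) p}.Countable ∨
      ∀ (s : ComplexPoints S) (W : complexBetti 𝒳 (2 * p)),
        (∀ s' : ComplexPoints S, IsRationalClass (complexBetti.map (fiberι f s') (2 * p) W) ∧
          IsOfHodgeType d (fiberOver f s') (2 * p) p p (complexBetti.map (fiberι f s') (2 * p) W)) →
        complexBetti.map (fiberι f s) (2 * p) W ∈ algebraicClasses (fiberOver f s) p := by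
  by_cases hall : ∀ (s : ComplexPoints S) (W : complexBetti 𝒳 (2 * p)),
      (∀ s' : ComplexPoints S, IsRationalClass (complexBetti.map (fiberι f s') (2 * p) W) ∧
        IsOfHodgeType d (fiberOver f s') (2 * p) p p (complexBetti.map (fiberι f s') (2 * p) W)) →
      complexBetti.map (fiberι f s) (2 * p) W ∈ algebraicClasses (fiberOver f s) p
  · exact Or.inr hall
  · push Not at hall
    obtain ⟨s₁, W, hW, hs₁⟩ := hall
    refine Or.inl ?_
    rcases algebraicityLocus_countable_or_forall hf.isSmoothProjective_base
      (IsQuasiProjectiveOver.of_isProjectiveOver hf.isSmoothProjective_total.isProjectiveOver)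
      hf.isSmoothProjectiveFamily W with hc | hforall
    · exact hc.mono fun s hs ↦ hs W hW
    · exact absurd (hforall s₁) hs₁

/-- **UNCOUNTABLY MANY GOOD FIBRES ⟹ EVERY FIBRE IS GOOD (fact-free).** [cite: CharlesSchnell2014Notes, Prop. 11.3.11 (proof)] -/
theorem forall_good_of_not_countable_good (hf : IsCompactAbelianPencil f d) (p : ℕ)
    (h : ¬ {s : ComplexPoints S | ∀ W : complexBetti 𝒳 (2 * p),
        (∀ s' : ComplexPoints S, IsRationalClass (complexBetti.map (fiberι f s') (2 * p) W) ∧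
          IsOfHodgeType d (fiberOver f s') (2 * p) p p (complexBetti.map (fiberι f s') (2 * p) W)) →
        complexBetti.map (fiberι f s) (2 * p) W ∈ algebraicClasses (fiberOver f s) p}.Countable)
    (s : ComplexPoints S) (W : complexBetti 𝒳 (2 * p))
    (hW : ∀ s' : ComplexPoints S, IsRationalClass (complexBetti.map (fiberι f s') (2 * p) W) ∧
      IsOfHodgeType d (fiberOver f s') (2 * p) p p (complexBetti.map (fiberι f s') (2 * p) W)) :
    complexBetti.map (fiberι f s) (2 * p) W ∈ algebraicClasses (fiberOver f s) p :=
  ((goodFibres_countable_or_forall hf p).resolve_left h) s W hW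

/-! ## §2 Uncountably many good fibres give the lift everywhere (Verdier) and Abdulali's transport (fact-free) -/

/-- **UNCOUNTABLY MANY GOOD FIBRES ⟹ `(L)_t(p)` AT EVERY `t`, granted Verdier** (sharpening of part XXXI-b §7: only
the INVARIANT Hodge classes of the members — the global classes with rational `(p,p)` restrictions — are asked to be
algebraic, on uncountably many of them). A rational class algebraic on `𝒳_t` has rational `(p,p)` restrictions (part
XVII-a), is algebraic on every fibre by §1, and is lifted by part XX-a's engine; part XVII-b reduces to rational classes.
[cite: Verdier1976, Cor. (5.1)] [cite: CharlesSchnell2014Notes, Prop. 11.3.5 and Cor. 11.3.6] -/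
theorem comap_le_sup_of_not_countable_good_of_verdier (hGT : Verdier1976_genericLocalTriviality)
    (hf : IsCompactAbelianPencil f d) (p : ℕ)
    (h : ¬ {s : ComplexPoints S | ∀ W : complexBetti 𝒳 (2 * p),
        (∀ s' : ComplexPoints S, IsRationalClass (complexBetti.map (fiberι f s') (2 * p) W) ∧
          IsOfHodgeType d (fiberOver f s') (2 * p) p p (complexBetti.map (fiberι f s') (2 * p) W)) →
        complexBetti.map (fiberι f s) (2 * p) W ∈ algebraicClasses (fiberOver f s) p}.Countable)
    (t : ComplexPoints S) :
    (algebraicClasses (fiberOver f t) p).comap (complexBetti.map (fiberι f t) (2 * p)).hom ≤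
      algebraicClasses 𝒳 p ⊔ LinearMap.ker (complexBetti.map (fiberι f t) (2 * p)).hom := by
  intro W hW
  have hW' : complexBetti.map (fiberι f t) (2 * p) W ∈ algebraicClasses (fiberOver f t) p := hW
  refine (Submodule.span_le (p := algebraicClasses 𝒳 p ⊔
    LinearMap.ker (complexBetti.map (fiberι f t) (2 * p)).hom)).2 ?_
    (mem_span_rational_of_map_fiberι_mem_algebraicClasses hf hW')
  rintro W' ⟨hW'rat, hW'alg⟩
  obtain ⟨η, hη, hηW'⟩ := exists_algebraic_lift_of_forall_mem_algebraicClasses_of_verdier hGT hf W'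
    (fun s ↦ forall_good_of_not_countable_good hf p h s W'
      (fibrewiseHodge_of_isRationalClass_of_mem_algebraicClasses hf hW'rat hW'alg))
  change W' ∈ algebraicClasses 𝒳 p ⊔ LinearMap.ker (complexBetti.map (fiberι f t) (2 * p)).hom
  rw [show W' = η + (W' - η) by abel]
  refine Submodule.add_mem_sup hη ?_
  rw [LinearMap.mem_ker, map_sub, sub_eq_zero]
  exact (hηW' t).symm

/-- **Uncountably many good fibres in every degree ⟹ Abdulali's (1.1)_f (fact-free)**: every fibre is good (§1), so
every global class with rational `(p,p)` restrictions is algebraic on every fibre — in particular transport holds.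
[cite: Abdulali1994FamiliesAV, (1.1) (p. 1122)] [cite: CharlesSchnell2014Notes, Prop. 11.3.11 (proof)] -/
theorem invariantCyclesHoldFor_of_forall_not_countable_good (hf : IsCompactAbelianPencil f d)
    (h : ∀ p : ℕ, ¬ {s : ComplexPoints S | ∀ W : complexBetti 𝒳 (2 * p),
        (∀ s' : ComplexPoints S, IsRationalClass (complexBetti.map (fiberι f s') (2 * p) W) ∧
          IsOfHodgeType d (fiberOver f s') (2 * p) p p (complexBetti.map (fiberι f s') (2 * p) W)) →
        complexBetti.map (fiberι f s) (2 * p) W ∈ algebraicClasses (fiberOver f s) p}.Countable) :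
    InvariantCyclesHoldFor f d :=
  fun p W hW _ s ↦ forall_good_of_not_countable_good hf p (h p) s W hW

/-! ## §3 Under `HC_CM`: CM fibres are good; `B_min` on a pencil ⟺ uncountably many good fibres; all CM points or none -/

/-- **CM fibres are good, granted `HC_CM`**: at a CM point, a global class with rational `(p,p)` restriction is
algebraic on the fibre (`Ring2Transport.mem_algebraicClasses_of_cmChart`). `HC_CM` a BINDER.
[cite: Deligne1982HodgeCycles, §6 proof of Prop. 6.1] [cite: Andre1996Motifs, §6.3 a) (p. 33)] -/
theorem good_of_mem_cmLocus_of_HC_CM (hCM : RankFourFaces.CMAbelianHodge) {t : ComplexPoints S}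
    (ht : t ∈ cmLocus f d) (p : ℕ) (W : complexBetti 𝒳 (2 * p))
    (hW : ∀ s' : ComplexPoints S, IsRationalClass (complexBetti.map (fiberι f s') (2 * p) W) ∧
      IsOfHodgeType d (fiberOver f s') (2 * p) p p (complexBetti.map (fiberι f s') (2 * p) W)) :
    complexBetti.map (fiberι f t) (2 * p) W ∈ algebraicClasses (fiberOver f t) p := by
  obtain ⟨A₀, ⟨e₀⟩, hdim, hcm⟩ := ht
  exact Ring2Transport.mem_algebraicClasses_of_cmChart hCM A₀ e₀ hdim hcm (hW t).1 (hW t).2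

/-- **A PENCIL WITH UNCOUNTABLE CM LOCUS SATISFIES `B_min` OUTRIGHT, granted `HC_CM` and Verdier**: its CM fibres are
good (§3) and uncountably many, so `(L)_t(p)` holds at every `t` (§2). (The constant pencils of seat ab-spread-1 are
the basic example; any isotrivial CM pencil qualifies — AND ONLY ISOTRIVIAL PENCILS DO (REFEREE-AB F-ab-131 (b)): complex CM
abelian varieties of a given dimension form countably many isomorphism classes and a non-isotrivial pencil over a curve meets
each of them in finitely many fibres, so a non-isotrivial pencil has countably many CM fibres; in print, not typed here for want
of a moduli carrier. This row is therefore the constant-pencil PIVOT of spread part XXXI again, not a new case.) `HC_CM` a BINDER.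
[cite: Verdier1976, Cor. (5.1)] [cite: Andre1996Motifs, §6.3 a) (p. 33)] -/
theorem comap_le_sup_of_not_countable_cmLocus_of_HC_CM_of_verdier (hGT : Verdier1976_genericLocalTriviality)
    (hCM : RankFourFaces.CMAbelianHodge) (hf : IsCompactAbelianPencil f d) (hunc : ¬ (cmLocus f d).Countable)
    (p : ℕ) (t : ComplexPoints S) :
    (algebraicClasses (fiberOver f t) p).comap (complexBetti.map (fiberι f t) (2 * p)).hom ≤
      algebraicClasses 𝒳 p ⊔ LinearMap.ker (complexBetti.map (fiberι f t) (2 * p)).hom :=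
  comap_le_sup_of_not_countable_good_of_verdier hGT hf p
    (fun hc ↦ hunc (hc.mono fun _ hs W hW ↦ good_of_mem_cmLocus_of_HC_CM hCM hs p W hW)) t

/-- **`(L)` at a CM point makes EVERY fibre good, granted `HC_CM` (fact-free otherwise)**: a global class with rational
`(p,p)` restrictions is algebraic on the CM fibre (§3), hence — by the lift at `t`, part XXXI-a
`forall_mem_algebraicClasses_of_comap_le_sup` — on every fibre. `HC_CM` a BINDER. [cite: Andre1996Motifs, §5.1 (A4) (p. 25) and §6.3 a) (p. 33)] -/
theorem forall_good_of_comap_le_sup_cm_of_HC_CM (hCM : RankFourFaces.CMAbelianHodge) (hf : IsCompactAbelianPencil f d)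
    {p : ℕ} {t : ComplexPoints S} (ht : t ∈ cmLocus f d)
    (hL : (algebraicClasses (fiberOver f t) p).comap (complexBetti.map (fiberι f t) (2 * p)).hom ≤
      algebraicClasses 𝒳 p ⊔ LinearMap.ker (complexBetti.map (fiberι f t) (2 * p)).hom)
    (s : ComplexPoints S) (W : complexBetti 𝒳 (2 * p))
    (hW : ∀ s' : ComplexPoints S, IsRationalClass (complexBetti.map (fiberι f s') (2 * p) W) ∧
      IsOfHodgeType d (fiberOver f s') (2 * p) p p (complexBetti.map (fiberι f s') (2 * p) W)) :
    complexBetti.map (fiberι f s) (2 * p) W ∈ algebraicClasses (fiberOver f s) p :=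
  forall_mem_algebraicClasses_of_comap_le_sup hf.isSmoothProjective_base hf.isSmoothProjectiveFamily hL
    (good_of_mem_cmLocus_of_HC_CM hCM ht p W hW) s

/-- **`B_min` ON ONE PENCIL, READ THROUGH THE GOOD FIBRES (granted `HC_CM` and Verdier): at a CM point `t`,
`(L)_t(p)` ⟺ the `p`-good fibres are UNCOUNTABLY many.** (⟹: every fibre is good and `S(ℂ)` is uncountable;
⟸: §2.) `HC_CM` a BINDER. [cite: Verdier1976, Cor. (5.1)] [cite: Andre1996Motifs, §6.3 a) and Remarque 2 (p. 33)]
[cite: CharlesSchnell2014Notes, Cor. 11.3.6] -/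
theorem comap_le_sup_iff_not_countable_good_of_HC_CM_of_verdier (hGT : Verdier1976_genericLocalTriviality)
    (hCM : RankFourFaces.CMAbelianHodge) (hf : IsCompactAbelianPencil f d) (p : ℕ) {t : ComplexPoints S}
    (ht : t ∈ cmLocus f d) :
    (algebraicClasses (fiberOver f t) p).comap (complexBetti.map (fiberι f t) (2 * p)).hom ≤
        algebraicClasses 𝒳 p ⊔ LinearMap.ker (complexBetti.map (fiberι f t) (2 * p)).hom ↔
      ¬ {s : ComplexPoints S | ∀ W : complexBetti 𝒳 (2 * p),
          (∀ s' : ComplexPoints S, IsRationalClass (complexBetti.map (fiberι f s') (2 * p) W) ∧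
            IsOfHodgeType d (fiberOver f s') (2 * p) p p (complexBetti.map (fiberι f s') (2 * p) W)) →
          complexBetti.map (fiberι f s) (2 * p) W ∈ algebraicClasses (fiberOver f s) p}.Countable :=
  ⟨fun hL ↦ not_countable_of_forall_mem_of_curve hf.isSmoothProjective_base t
      (fun s W hW ↦ forall_good_of_comap_le_sup_cm_of_HC_CM hCM hf ht hL s W hW),
    fun h ↦ comap_le_sup_of_not_countable_good_of_verdier hGT hf p h t⟩

/-- The same with "every fibre is good" on the right. `HC_CM` a BINDER. [cite: Verdier1976, Cor. (5.1)]
[cite: Andre1996Motifs, §6.3 a) and Remarque 2 (p. 33)] -/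
theorem comap_le_sup_iff_forall_good_of_HC_CM_of_verdier (hGT : Verdier1976_genericLocalTriviality)
    (hCM : RankFourFaces.CMAbelianHodge) (hf : IsCompactAbelianPencil f d) (p : ℕ) {t : ComplexPoints S}
    (ht : t ∈ cmLocus f d) :
    (algebraicClasses (fiberOver f t) p).comap (complexBetti.map (fiberι f t) (2 * p)).hom ≤
        algebraicClasses 𝒳 p ⊔ LinearMap.ker (complexBetti.map (fiberι f t) (2 * p)).hom ↔
      ∀ (s : ComplexPoints S) (W : complexBetti 𝒳 (2 * p)),
        (∀ s' : ComplexPoints S, IsRationalClass (complexBetti.map (fiberι f s') (2 * p) W) ∧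
          IsOfHodgeType d (fiberOver f s') (2 * p) p p (complexBetti.map (fiberι f s') (2 * p) W)) →
        complexBetti.map (fiberι f s) (2 * p) W ∈ algebraicClasses (fiberOver f s) p :=
  ⟨fun hL s W hW ↦ forall_good_of_comap_le_sup_cm_of_HC_CM hCM hf ht hL s W hW,
    fun h ↦ comap_le_sup_of_not_countable_good_of_verdier hGT hf p
      (not_countable_of_forall_mem_of_curve hf.isSmoothProjective_base t (fun s W hW ↦ h s W hW)) t⟩

/-- **ALL CM POINTS OR NONE — indeed all points: `(L)_t(p)` at ONE CM point of a pencil gives `(L)_s(p)` at EVERY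
point `s`, granted `HC_CM` and Verdier** (every fibre becomes good; §2). So on a CM-pointed compact pencil the
André-axis `B_min` in degree `2p` is ONE condition on the pencil, not one per CM point. `HC_CM` a BINDER.
[cite: Verdier1976, Cor. (5.1)] [cite: Andre1996Motifs, §6.3 a) and Remarque 2 (p. 33)] -/
theorem comap_le_sup_of_comap_le_sup_cm_of_HC_CM_of_verdier (hGT : Verdier1976_genericLocalTriviality)
    (hCM : RankFourFaces.CMAbelianHodge) (hf : IsCompactAbelianPencil f d) {p : ℕ} {t : ComplexPoints S}
    (ht : t ∈ cmLocus f d)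
    (hL : (algebraicClasses (fiberOver f t) p).comap (complexBetti.map (fiberι f t) (2 * p)).hom ≤
      algebraicClasses 𝒳 p ⊔ LinearMap.ker (complexBetti.map (fiberι f t) (2 * p)).hom)
    (s : ComplexPoints S) :
    (algebraicClasses (fiberOver f s) p).comap (complexBetti.map (fiberι f s) (2 * p)).hom ≤
      algebraicClasses 𝒳 p ⊔ LinearMap.ker (complexBetti.map (fiberι f s) (2 * p)).hom :=
  comap_le_sup_of_not_countable_good_of_verdier hGT hf p
    ((comap_le_sup_iff_not_countable_good_of_HC_CM_of_verdier hGT hCM hf p ht).1 hL) s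

end Summit.HodgeConjecture.HodgeConjecture.Ring2.AbelianAll

end
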